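import Summits.NavierStokesRegularity.NavierStokesRegularity.Theorems.ExtremiserTransiencePlateauSliceRigidity
import HarnessLib

/-!
# Route `ExtremiserTransience` — LINE g6-α «regularised bang-bang» (seat ns-idea-5 g6): the glue of the split of
# `NearExtremalTransiencePerFlow` (26567), and the comparison with the universal-constant crux

`--supports stmt-NavierStokesRegularity-28319` (the glue item `NETPFOfRegularised` of the split of `NearExtremalTransiencePerFlow`,
stmt-26567, into `RegularisedNearPlateauStability` (28317, crux) and `RegularisedSliceTransfer` (28318, support); route rev 21).

Content (pure logic, kernel-checked against the route file and the landed `plateauSliceRigidity`, item 27823):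
* `netpfOfRegularised : NETPFOfRegularised` — the regularised crux and the regularised slice transfer produce, for a
  certificate-free Type-I singular Leray–Hopf flow, the weak-class one-slice plateau object, which `plateauSliceRigidity` excludes;
  so the per-flow depletion certificate exists (by contradiction);
* `regularised_of_lnps : LocalNearPlateauStability → RegularisedNearPlateauStability` — the universal-constant crux (27676)
  implies the regularised one by instantiation (the regularity budget `A` is simply not used), recording that the new crux is the
  WEAKER statement; the converse is not claimed;
* `netpf_of_regularised : RegularisedNearPlateauStability → RegularisedSliceTransfer → NearExtremalTransiencePerFlow` — the rung
  26567 by name.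
So after this file the OPEN content of LINE g6-α is exactly {28317 (crux), 28318 (transfer)}.
WHY THE SPLIT: the quantitative bang-bang argument for near-extremisers of the depletion functional (slack first variation, a sup bound
for the first-variation density `G` of `…KStarAttainedDensity.exists_density`, localisation to a self-efficient ball, level-set split of
the local self-test) consumes pointwise bounds on six derivatives of the field at the dissipation length `λ = √(Z/P)`; Type-I parabolic
smoothing, Leray's lower rate and the landed two-sided scale lock (`PerFlow.scaleLock_at_nearEfficient_times`) supply exactly such a
per-flow budget on the slices where the crux is applied (docstrings of 28317/28318).
HONEST FRAMING: implications between OPEN statements about hypothetical Type-I singular flows; nothing about Navier–Stokes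
regularity or blow-up is proved here, and no summit is proved by a line. [folklore]
-/

namespace Summit.NavierStokesRegularity.NavierStokesRegularity.Theses.ExtremiserTransience
set_option linter.dupNamespace false

/-- The glue item `NETPFOfRegularised` (stmt-NavierStokesRegularity-28319): by contradiction through `plateauSliceRigidity`. [folklore] -/
theorem netpfOfRegularised : NETPFOfRegularised := by
  intro h1 h2 C ν T hC hν hT0 u p hcl hLH hdec hrate hnoext
  by_contra hno
  exact plateauSliceRigidity (h2 h1 C ν T hC hν hT0 u p hcl hLH hdec hrate hnoext hno)

/-- The universal-constant crux `LocalNearPlateauStability` (27676) implies the regularised crux (28317): instantiate and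
ignore the regularity budget. [folklore] -/
theorem regularised_of_lnps (h : LocalNearPlateauStability) : RegularisedNearPlateauStability := by
  intro A _hA
  obtain ⟨c₀, r, hc₀, hr, H⟩ := h
  refine ⟨c₀, r, hc₀, hr, fun δ hδ => ?_⟩
  obtain ⟨ε, hε, Hε⟩ := H δ hδ
  exact ⟨ε, hε, fun v M B hv hdiv hM hB h0 h1 h2 _hreg hpos heff => Hε v M B hv hdiv hM hB h0 h1 h2 hpos heff⟩

/-- The rung `NearExtremalTransiencePerFlow` (26567) from the two open pieces of LINE g6-α, by name. [folklore] -/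
theorem netpf_of_regularised (h1 : RegularisedNearPlateauStability) (h2 : RegularisedSliceTransfer) :
    NearExtremalTransiencePerFlow :=
  netpfOfRegularised h1 h2

end Summit.NavierStokesRegularity.NavierStokesRegularity.Theses.ExtremiserTransience
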